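import Summits.Ventures.PercRepro.S1DisjointSumFourFiveProfile

/-!
# PercRepro — THE `(4, 5)`-SPLIT CONSUMER AT `(9, 4)`: A COLOOP-FREE SIMPLE RANK-4 PART ON 7 POINTS ⊕ A
COLOOP-FREE SIMPLE RANK-5 PART ON 7 POINTS (p2, gen 28; SUBCLAIM-S1 §6.10 (xvii)(j))

The last non-circuit `1`-separable shape of the `(9, 5)` cell. `#U(M ⊕ N; 9, 4) = N_M(4, 2) N_N(5, 2) +
N_M(4, 3) N_N(5, 1) ≤ 42 N_N(5, 2) + 245` (`N_M(4, 2) ≤ 21 + #big ≤ 42` by the incidence double count,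
`N_M(4, 3) ≤ C(7, 4) = 35`, `N_N(5, 1) ≤ 7`), `#Y(M ⊕ N; 9, 4) ≥ 2416 + 120 (f_N(3) + f_N(4))` (`f_M(2) + f_M(3) +
f_M(4) ≥ 120`, `f_M(3) + f_M(4) ≥ 78`, `f_M(2) ≥ 21`, `f_M(1) ≥ 7`, `f_N(1) ≥ 7`, `f_N(2) ≥ 21`, `f_N(5) ≥ 8`), and
Theorem N at `(5, 2)` on `N` (`Φ = 10/3`) bounds `N_N(5, 2) ≤ (3/10)(f_N(3) + f_N(4))`:
`Φ(9, 4) · #U ≤ 2058 + 105.84 T ≤ 2416 + 120 T`. Nothing is claimed about any cell.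

* `ncard_U_disjointSum_four_five_le`, `ncard_Y_disjointSum_four_five_ge`, `consumer_arith_four_five`;
* **`c025_nine_four_disjointSum_four_five`** — the consumer.
Axioms: standard.
-/

open scoped Matroid

namespace PercRepro

namespace S1

open Set

variable {α : Type}

/-- **The `U`-side of the `(4, 5)` split**: `#U(M ⊕ N; 9, 4) ≤ 42 N_N(5, 2) + 245`. -/
theorem ncard_U_disjointSum_four_five_le (M N : Matroid α) [M.Finite] [N.Finite] (h : Disjoint M.E N.E)
    (hM : M.eRank = ((4 : ℕ) : ℕ∞)) (hME : M.E.ncard = 7) (hcolM : M.coloops = ∅)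
    (hpairsM : ∀ e ∈ M.E, ∀ f ∈ M.E, e ≠ f → M.eRk {e, f} = 2) (hN : N.eRank = ((5 : ℕ) : ℕ∞))
    (hNE : N.E.ncard = 7) (hpairsN : ∀ e ∈ N.E, ∀ f ∈ N.E, e ≠ f → N.eRk {e, f} = 2) :
    {A : Set α | A ⊆ (M.disjointSum N h).E ∧ (M.disjointSum N h).eRk A = ((9 : ℕ) : ℕ∞) ∧
        (M.disjointSum N h).eRk ((M.disjointSum N h).E \ A) = ((4 : ℕ) : ℕ∞)}.ncard ≤
      42 * (profileSet N 5 2).ncard + 245 := by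
  rw [disjointSum_ncard_U_eq_finsum M N h 9 4, finsum_mem_coe_finset]
  rw [Finset.sum_eq_add_of_mem (4, 2) (4, 3) (by decide) (by decide) (by decide) ?_]
  · dsimp only
    rw [show (9 : ℕ) - 4 = 5 from rfl, show (4 : ℕ) - 2 = 2 from rfl, show (4 : ℕ) - 3 = 1 from rfl]
    have hcl : ∀ x ∈ M.E, ∀ y ∈ M.E, x ≠ y → (M.closure {x, y}).ncard ≤ 4 := by
      intro x hx y hy hxy
      have := ncard_closure_pair_le_of_coloops' M hM (by norm_num) hcolM hpairsM hx hy hxy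
      rw [hME] at this
      omega
    have hbig := ncard_bigRankTwo_le_choose M hpairsM hcl
    rw [hME, show Nat.choose 7 2 = 21 by decide] at hbig
    have h42 := ncard_profileSet_four_two_le_add M hME
    have h42' : (profileSet M 4 2).ncard ≤ 42 := by omega
    have h43 := ncard_profileSet_le_choose_of_ncard_eq (N := M) (a := 4) (b := 3) hME
    rw [show Nat.choose (4 + 3) 4 = 35 by decide] at h43
    have h51 := ncard_profileSet_top_one_le_of_pairs' hpairsN 5
    rw [hNE] at h51
    calc (profileSet M 4 2).ncard * (profileSet N 5 2).ncard + (profileSet M 4 3).ncard * (profileSet N 5 1).ncard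
        ≤ 42 * (profileSet N 5 2).ncard + 35 * 7 :=
          Nat.add_le_add (Nat.mul_le_mul_right _ h42') (Nat.mul_le_mul h43 h51)
      _ = 42 * (profileSet N 5 2).ncard + 245 := by ring
  · rintro ⟨a, b⟩ hmem ⟨hne1, hne2⟩
    rw [Finset.mem_product, Finset.mem_range, Finset.mem_range] at hmem
    dsimp only
    rcases Nat.lt_or_ge 4 a with ha | ha
    · rw [profileSet_eq_empty_of_eRank_lt M hM ha b, ncard_empty, zero_mul]
    rcases Nat.lt_or_ge a 4 with ha' | ha'
    · have h9a : 5 < 9 - a := by omega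
      rw [profileSet_eq_empty_of_eRank_lt N hN h9a (4 - b), ncard_empty, mul_zero]
    have ha4 : a = 4 := by omega
    subst ha4
    rw [show (9 : ℕ) - 4 = 5 from rfl]
    rcases Nat.lt_or_ge b 2 with hb | hb
    · -- `b ≤ 1`: the `N`-complement would need `≥ 3` points beside a spanning set of `≥ 5` points
      have h7 : N.E.ncard < 5 + (4 - b) := by rw [hNE]; omega
      rw [profileSet_eq_empty_of_ncard_lt N h7, ncard_empty, mul_zero]
    · have hb4 : b = 4 := by
        rcases Nat.lt_or_ge b 4 with hb4 | hb4
        · exfalso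
          rcases Nat.lt_or_ge b 3 with hb3 | hb3
          · exact hne1 (by congr 1; omega)
          · exact hne2 (by congr 1; omega)
        · omega
      subst hb4
      -- `N_M(4, 4) = ∅` on `7` points
      rw [profileSet_eq_empty_of_ncard_lt M (by rw [hME]; norm_num : M.E.ncard < 4 + 4), ncard_empty, zero_mul]

/-- **The `Y`-side of the `(4, 5)` split**: `#Y(M ⊕ N; 9, 4) ≥ 2416 + 120 (f_N(3) + f_N(4))`. -/
theorem ncard_Y_disjointSum_four_five_ge (M N : Matroid α) [M.Finite] [N.Finite] (h : Disjoint M.E N.E)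
    (hM : M.eRank = ((4 : ℕ) : ℕ∞)) (hME : M.E.ncard = 7) (hcolM : M.coloops = ∅)
    (hpairsM : ∀ e ∈ M.E, ∀ f ∈ M.E, e ≠ f → M.eRk {e, f} = 2) (hN : N.eRank = ((5 : ℕ) : ℕ∞))
    (hNE : N.E.ncard = 7) (hcolN : N.coloops = ∅) (hpairsN : ∀ e ∈ N.E, ∀ f ∈ N.E, e ≠ f → N.eRk {e, f} = 2) :
    2416 + 120 * ((rankSet N 3).ncard + (rankSet N 4).ncard) ≤
      {A : Set α | A ⊆ (M.disjointSum N h).E ∧ ((4 : ℕ) : ℕ∞) < (M.disjointSum N h).eRk A ∧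
        (M.disjointSum N h).eRk A < ((9 : ℕ) : ℕ∞)}.ncard := by
  rw [disjointSum_ncard_Y_eq_finsum M N h 9 4, finsum_mem_coe_finset]
  have hsub : ({(4, 1), (4, 2), (4, 3), (4, 4), (3, 2), (3, 3), (3, 4), (3, 5), (2, 3), (2, 4), (2, 5), (1, 4),
      (1, 5), (0, 5)} : Finset (ℕ × ℕ)) ⊆
      (Finset.range 9 ×ˢ Finset.range 9).filter (fun x : ℕ × ℕ => 4 < x.1 + x.2 ∧ x.1 + x.2 < 9) := by
    decide
  refine le_trans ?_ (Finset.sum_le_sum_of_subset hsub)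
  rw [Finset.sum_insert (by decide), Finset.sum_insert (by decide), Finset.sum_insert (by decide),
    Finset.sum_insert (by decide), Finset.sum_insert (by decide), Finset.sum_insert (by decide),
    Finset.sum_insert (by decide), Finset.sum_insert (by decide), Finset.sum_insert (by decide),
    Finset.sum_insert (by decide), Finset.sum_insert (by decide), Finset.sum_insert (by decide),
    Finset.sum_insert (by decide), Finset.sum_singleton]
  dsimp only
  -- the `M`-side counts
  have hcl : ∀ x ∈ M.E, ∀ y ∈ M.E, x ≠ y → (M.closure {x, y}).ncard ≤ 4 := by
    intro x hx y hy hxy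
    have := ncard_closure_pair_le_of_coloops' M hM (by norm_num) hcolM hpairsM hx hy hxy
    rw [hME] at this
    omega
  have hbig := ncard_bigRankTwo_le_choose M hpairsM hcl
  rw [hME, show Nat.choose 7 2 = 21 by decide] at hbig
  have hF2hi := ncard_rankSet_two_le_add_big M
  rw [hME, show Nat.choose 7 2 = 21 by decide] at hF2hi
  have hF234 := ncard_rankSet_two_three_four_ge_of_pairs M hM hpairsM
  rw [hME, show 2 ^ 7 - 1 - 7 = 120 by decide] at hF234
  have F2 : 21 ≤ (rankSet M 2).ncard := by
    have := choose_le_ncard_rankSet_two_of_pairs hpairsM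
    rwa [hME, show Nat.choose 7 2 = 21 by decide] at this
  have F1 : 7 ≤ (rankSet M 1).ncard := by
    have := ncard_le_ncard_rankSet_one_of_pairs hpairsM (by omega)
    rwa [hME] at this
  have F0 : 1 ≤ (rankSet M 0).ncard := by
    have h0 : (∅ : Set α) ∈ rankSet M 0 := ⟨empty_subset _, by rw [M.eRk_empty]; rfl⟩
    exact (ncard_pos (rankSet_finite M 0)).mpr ⟨∅, h0⟩
  -- the `N`-side counts
  have G1 : 7 ≤ (rankSet N 1).ncard := by
    have := ncard_le_ncard_rankSet_one_of_pairs hpairsN (by omega)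
    rwa [hNE] at this
  have G2 : 21 ≤ (rankSet N 2).ncard := by
    have := choose_le_ncard_rankSet_two_of_pairs hpairsN
    rwa [hNE, show Nat.choose 7 2 = 21 by decide] at this
  have G5 : 8 ≤ (rankSet N 5).ncard := by
    have := succ_le_ncard_rankSet_top_of_coloops N hN hcolN
    rwa [hNE] at this
  -- the product bounds
  have e41 := Nat.mul_le_mul_left (rankSet M 4).ncard G1
  have e42 := Nat.mul_le_mul_left (rankSet M 4).ncard G2
  have e32 := Nat.mul_le_mul_left (rankSet M 3).ncard G2
  have e35 := Nat.mul_le_mul_left (rankSet M 3).ncard G5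
  have e25 := Nat.mul_le_mul_left (rankSet M 2).ncard G5
  have e15 := Nat.mul_le_mul F1 G5
  have e05 := Nat.mul_le_mul F0 G5
  have eT3 := Nat.mul_le_mul_right (rankSet N 3).ncard hF234
  have eT4 := Nat.mul_le_mul_right (rankSet N 4).ncard hF234
  rw [add_mul, add_mul] at eT3 eT4
  have n14 : 0 ≤ (rankSet M 1).ncard * (rankSet N 4).ncard := Nat.zero_le _
  -- `28 f(4) + 29 f(3) + 8 f(2) ≥ 28 (f(3) + f(4)) + 8 f(2) ≥ 28 · 78 + 8 · 21`
  have hG : 78 ≤ (rankSet M 3).ncard + (rankSet M 4).ncard := by omega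
  nlinarith [e41, e42, e32, e35, e25, e15, e05, eT3, eT4, n14, hG, F2]

/-- The arithmetic of the `(4, 5)`-split consumer: `u ≤ 42 P₂ + 245`, `(10/3) P₂ ≤ T`, `y ≥ 2416 + 120 T` give
`(42/5) u ≤ y`. -/
theorem consumer_arith_four_five {u y P2 T : ℚ} (hU : u ≤ 42 * P2 + 245) (h52 : 10 / 3 * P2 ≤ T)
    (hY : 2416 + 120 * T ≤ y) (hT : 0 ≤ T) : 42 / 5 * u ≤ y := by
  linarith

/-- **THE `(4, 5)`-SPLIT CONSUMER**: `Φ(9, 4) · #U(M ⊕ N; 9, 4) ≤ #Y(M ⊕ N; 9, 4)` for every finite coloop-free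
`M` of rank `4` on `7` points and every finite coloop-free `N` of rank `5` on `7` points, both with all pairs of
distinct points of rank `2` — from Theorem N at `(5, 2)` on `N`, the incidence double count on `M` and the two
profiles. -/
theorem c025_nine_four_disjointSum_four_five (M N : Matroid α) [M.Finite] [N.Finite]
    (h : Disjoint M.E N.E) (hM : M.eRank = ((4 : ℕ) : ℕ∞)) (hME : M.E.ncard = 7) (hcolM : M.coloops = ∅)
    (hpairsM : ∀ e ∈ M.E, ∀ f ∈ M.E, e ≠ f → M.eRk {e, f} = 2) (hN : N.eRank = ((5 : ℕ) : ℕ∞))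
    (hNE : N.E.ncard = 7) (hcolN : N.coloops = ∅) (hpairsN : ∀ e ∈ N.E, ∀ f ∈ N.E, e ≠ f → N.eRk {e, f} = 2) :
    phiK 9 4 * ({A : Set α | A ⊆ (M.disjointSum N h).E ∧ (M.disjointSum N h).eRk A = ((9 : ℕ) : ℕ∞) ∧
        (M.disjointSum N h).eRk ((M.disjointSum N h).E \ A) = ((4 : ℕ) : ℕ∞)}.ncard : ℚ) ≤
      ({A : Set α | A ⊆ (M.disjointSum N h).E ∧ ((4 : ℕ) : ℕ∞) < (M.disjointSum N h).eRk A ∧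
        (M.disjointSum N h).eRk A < ((9 : ℕ) : ℕ∞)}.ncard : ℚ) := by
  have hU := ncard_U_disjointSum_four_five_le M N h hM hME hcolM hpairsM hN hNE hpairsN
  have hY := ncard_Y_disjointSum_four_five_ge M N h hM hME hcolM hpairsM hN hNE hcolN hpairsN
  have h52 : (10 / 3 : ℚ) * ((profileSet N 5 2).ncard : ℚ) ≤
      ((rankSet N 3).ncard : ℚ) + ((rankSet N 4).ncard : ℚ) := by
    have h0 := ThmN.c025_two_all N 5 (by norm_num)
    unfold ThmN.RLS at h0
    rw [phiK_five_two, ySet_eq_rankSet_union_of_eq N (q := 2) (p := 5) (k := 3) (k' := 4) rfl rfl rfl,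
      ncard_union_eq (rankSet_disjoint_of_ne N (by norm_num)) (rankSet_finite N 3) (rankSet_finite N 4)] at h0
    push_cast at h0
    exact h0
  rw [phiK_nine_four]
  have hU' : (({A : Set α | A ⊆ (M.disjointSum N h).E ∧ (M.disjointSum N h).eRk A = ((9 : ℕ) : ℕ∞) ∧
      (M.disjointSum N h).eRk ((M.disjointSum N h).E \ A) = ((4 : ℕ) : ℕ∞)}.ncard : ℕ) : ℚ) ≤
      42 * ((profileSet N 5 2).ncard : ℚ) + 245 := by
    exact_mod_cast hU
  have hY' : 2416 + 120 * (((rankSet N 3).ncard : ℚ) + ((rankSet N 4).ncard : ℚ)) ≤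
      (({A : Set α | A ⊆ (M.disjointSum N h).E ∧ ((4 : ℕ) : ℕ∞) < (M.disjointSum N h).eRk A ∧
        (M.disjointSum N h).eRk A < ((9 : ℕ) : ℕ∞)}.ncard : ℕ) : ℚ) := by
    exact_mod_cast hY
  have hT : (0 : ℚ) ≤ ((rankSet N 3).ncard : ℚ) + ((rankSet N 4).ncard : ℚ) := by positivity
  exact consumer_arith_four_five hU' h52 hY' hT

end S1

end PercRepro
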